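import Literature.Probability.RandomPlanarGeometry.StarHullCanonical
import Literature.Probability.RandomPlanarGeometry.LoewnerTube
import Literature.Probability.RandomPlanarGeometry.RestrictionDerivOuter
import Literature.Probability.RandomPlanarGeometry.HullSubordination
import Literature.Probability.RandomPlanarGeometry.HalfPlaneFillProofs
import Literature.Probability.RandomPlanarGeometry.LoewnerSlidHullStar
import HarnessLib

/-!
# Continuity in time of `t ↦ Φ'_{A_t}(W_t)` ([LSW] §5: "`h_t'(W_t)` is continuous in `t`")

For a continuous driving function `W`, a nonempty `*`-hull `A` and the times `t` at which the
closed Loewner hulls miss `A` (`Disjoint (closedHull W t) A`: the slid hull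
`B_t = A_t - W_t = slidHull W A t` is then a `*`-hull, `isStarHull_slidHull_of_disjoint`), we prove
that the two numbers which control the one-step estimates of `StarHullCanonical`,

* `m_t = infDist 0 B_t = dist(W_t, g_t(A)) > 0` and
* `d_t = starDeriv B_t = Φ'_{A_t}(W_t) = h_t'(W_t) ∈ (0, 1]`,

are **continuous in `t`** on this set of times (`continuousWithinAt_infDist_slidHull`,
`continuousWithinAt_starDeriv_slidHull`). Ingredients: the two-sided tube (`LoewnerTube`:
`B_v` is within `4|s-v|/m_s + osc W` of `B_s`, pointwise along the flow, on both sides of `s`);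
the antitonicity `B ⊆ H ⇒ d_H ≤ d_B` (`HasRestrictionDeriv.le_of_subset`) together with OUTER
continuity (`HasRestrictionDeriv.exists_forall_outer_ge`: thin thickened hulls `H ⊇ B_s` have
`d_H ≥ d_{B_s}/2`), which bound `d_v` from below near `s`; and the one-step estimate
`|d_{B'} - d_B| ≤ 50u/ρ₀² + 2η/ρ₀` (`abs_starDeriv_slidHull_sub_le`) applied forward from `s` and
forward from `v < s` (cocycle `slidHull_add`).

## References

* G. F. Lawler, O. Schramm, W. Werner, *Conformal restriction: the chordal case* (2003), §5
  (proof of Prop. 5.3: `h_t'(W_t)` continuous) [LawlerSchrammWerner2003Restriction].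
* G. F. Lawler, *Conformally Invariant Processes in the Plane* (2005), §4.6.1
  [Lawler2005].
-/

noncomputable section

open Set Filter Metric Function
open _root_.Complex _root_.Topology
open UpperHalfPlane (upperHalfPlaneSet)
open scoped NNReal

namespace Literature.Probability.RandomPlanarGeometry

namespace Loewner

variable {W : ℝ≥0 → ℝ} {A : Set ℂ}

/-! ### Alive times: basic facts -/

/-- Before the closed hulls meet `A`, every point of `A ⊆ ℍ̄` is still flowing. [folklore] -/
theorem lt_swallowingTime_of_alive (hA : IsStarHull A) {t : ℝ≥0} (ht : Disjoint (closedHull W t) A)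
    {a : ℂ} (ha : a ∈ A) : (t : WithTop ℝ≥0) < swallowingTime W a :=
  lt_swallowingTime_of_disjoint_closedHull hA.isBoundedHull.subset_closure ht ha

/-- Aliveness is inherited by earlier times. [folklore] -/
theorem alive_mono {s t : ℝ≥0} (hst : s ≤ t) (ht : Disjoint (closedHull W t) A) :
    Disjoint (closedHull W s) A :=
  ht.mono_left (closedHull_mono W hst)

/-- For a nonempty `*`-hull `B`, `m = infDist 0 B > 0` and `B` misses `ball 0 m`. [folklore] -/
theorem infDist_zero_pos {B : Set ℂ} (hB : IsStarHull B) (hne : B.Nonempty) :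
    0 < infDist 0 B ∧ Disjoint (ball (0 : ℂ) (infDist 0 B)) B := by
  refine ⟨(hB.isBoundedHull.isClosed.notMem_iff_infDist_pos hne).1 hB.zero_notMem, ?_⟩
  refine Set.disjoint_left.2 fun w hw hwB ↦ ?_
  have := infDist_le_dist_of_mem (x := (0 : ℂ)) hwB
  rw [mem_ball, dist_comm] at hw
  linarith

/-- Points of a slid hull lie in `ℍ̄`. [folklore] -/
theorem im_nonneg_of_mem_slidHull (hW : Continuous W) (hA : IsStarHull A) {t : ℝ≥0}
    (ht : Disjoint (closedHull W t) A) {w : ℂ} (hw : w ∈ slidHull W A t) : 0 ≤ w.im := by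
  have := (isStarHull_slidHull_of_disjoint hW hA ht).isBoundedHull.subset_closure hw
  rwa [show upperHalfPlaneSet = {z : ℂ | 0 < z.im} from rfl, Complex.closure_setOf_lt_im] at this

/-! ### The two-sided tube, packaged at an alive time -/

/-- **Local tube at an alive time `s`** (`A ≠ ∅`): there are `ρ > 0` (namely `m_s/16`) and, for
every `ε > 0`, a `δ > 0` such that for all alive `v` with `|v - s| ≤ δ`: the flow of every
`a ∈ A` satisfies `|(g_v(a) - W_v) - (g_s(a) - W_s)| ≤ ε`, `B_v` misses `ball 0 (8ρ)`, and the
oscillation of `W` on `[s ∧ v, s ∨ v]` is `≤ ε`. [cite: Lawler2005, Lemma 4.13] -/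
theorem exists_tube_at (hW : Continuous W) (hA : IsStarHull A) (hne : A.Nonempty) {s : ℝ≥0}
    (hs : Disjoint (closedHull W s) A) :
    ∃ ρ > 0, 16 * ρ = infDist 0 (slidHull W A s) ∧ ∀ ε > 0, ∃ δ > 0, ∀ v : ℝ≥0,
      Disjoint (closedHull W v) A → |(v : ℝ) - s| ≤ δ →
        (∀ a ∈ A, ‖(map W v a - W v) - (map W s a - W s)‖ ≤ ε) ∧
        Disjoint (ball (0 : ℂ) (8 * ρ)) (slidHull W A v) ∧
        (∀ r : ℝ≥0, min s v ≤ r → r ≤ max s v → |W r - W s| ≤ ε) := by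
  have hBs := isStarHull_slidHull_of_disjoint hW hA hs
  obtain ⟨hm0, -⟩ := infDist_zero_pos hBs (hne.image _)
  set m : ℝ := infDist 0 (slidHull W A s) with hm
  refine ⟨m / 16, by positivity, by ring, fun ε hε ↦ ?_⟩
  -- modulus of continuity of `W` at `s`, with `Ω = min ε (m/8) / 2`
  set Ω : ℝ := min (ε / 2) (m / 8) with hΩ
  have hΩ0 : 0 < Ω := lt_min (by positivity) (by positivity)
  have hWc : ContinuousAt (fun r : ℝ≥0 ↦ W r) s := hW.continuousAt
  rw [Metric.continuousAt_iff] at hWc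
  obtain ⟨δ₁, hδ₁, hmod⟩ := hWc Ω hΩ0
  -- `δ` so small that `4δ/m + Ω < m/2` and `4δ/m + Ω ≤ ε`
  set δ : ℝ := min (δ₁ / 2) (min (ε / 2) (m / 8) * m / 8) with hδ
  have hδ0 : 0 < δ := lt_min (by positivity) (by positivity)
  have hδ1 : δ < δ₁ := lt_of_le_of_lt (min_le_left _ _) (by linarith)
  have h4δ : 4 * δ / m ≤ min (ε / 2) (m / 8) / 2 := by
    rw [div_le_iff₀ hm0]
    have := min_le_right (δ₁ / 2) (min (ε / 2) (m / 8) * m / 8)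
    nlinarith [this, le_min (by positivity : (0:ℝ) ≤ ε / 2) (by positivity : (0:ℝ) ≤ m / 8)]
  have hsum_lt : 4 * δ / m + Ω < m / 2 := by
    have := min_le_right (ε / 2) (m / 8)
    linarith
  have hsum_le : 4 * δ / m + Ω ≤ ε := by
    have := min_le_left (ε / 2) (m / 8)
    linarith
  refine ⟨δ, hδ0, fun v hv hvs ↦ ?_⟩
  have hmodr : ∀ r : ℝ≥0, |(r : ℝ) - s| ≤ δ → |W r - W s| ≤ Ω := fun r hr ↦ by
    have := hmod (x := r) (by rw [NNReal.dist_eq]; linarith)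
    rw [Real.dist_eq] at this
    exact this.le
  have hosc : ∀ r : ℝ≥0, min s v ≤ r → r ≤ max s v → |W r - W s| ≤ Ω := fun r hr1 hr2 ↦ by
    refine hmodr r (abs_le.2 ⟨?_, ?_⟩)
    · have : ((min s v : ℝ≥0) : ℝ) ≤ r := by exact_mod_cast hr1
      rw [NNReal.coe_min] at this
      rcases le_total s v with h | h
      · rw [min_eq_left (by exact_mod_cast h : (s:ℝ) ≤ v)] at this; linarith
      · rw [min_eq_right (by exact_mod_cast h : (v:ℝ) ≤ s)] at this
        linarith [(abs_le.1 hvs).1]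
    · have : (r : ℝ) ≤ ((max s v : ℝ≥0) : ℝ) := by exact_mod_cast hr2
      rw [NNReal.coe_max] at this
      rcases le_total s v with h | h
      · rw [max_eq_right (by exact_mod_cast h : (s:ℝ) ≤ v)] at this
        linarith [(abs_le.1 hvs).2]
      · rw [max_eq_left (by exact_mod_cast h : (v:ℝ) ≤ s)] at this; linarith
  -- pointwise tube, in the two cases `v ≤ s`, `s ≤ v`
  have hpt : ∀ a ∈ A, m / 2 < ‖map W v a - W v‖ ∧ ‖(map W v a - W v) - (map W s a - W s)‖ ≤ ε := by
    intro a ha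
    have hms : m ≤ ‖map W s a - W s‖ := by
      have := infDist_le_dist_of_mem (x := (0 : ℂ)) (mem_slidHull_iff.2 ⟨a, ha, rfl⟩ : map W s a - W s ∈ slidHull W A s)
      rwa [dist_comm, dist_zero_right] at this
    rcases le_total v s with h | h
    · have hsmall : 4 * ((s : ℝ) - v) / m + Ω < m / 2 := by
        have : (s : ℝ) - v ≤ δ := by linarith [(abs_le.1 hvs).1]
        have : 4 * ((s : ℝ) - v) / m ≤ 4 * δ / m := by gcongr
        linarith
      obtain ⟨hfar, hmove⟩ := norm_map_sub_ge_of_before hW (lt_swallowingTime_of_alive hA hs ha) hm0 hms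
        (fun r hr1 hr2 ↦ hosc r (by rw [min_eq_right h]; exact hr1) (by rw [max_eq_left h]; exact hr2)) hsmall le_rfl h
      refine ⟨hfar, ?_⟩
      calc ‖(map W v a - W v) - (map W s a - W s)‖ = ‖-(map W s a - map W v a) + (((W s - W v : ℝ)) : ℂ)‖ := by
            push_cast; ring_nf
        _ ≤ ‖-(map W s a - map W v a)‖ + ‖(((W s - W v : ℝ)) : ℂ)‖ := norm_add_le _ _
        _ ≤ 4 / m * ((s : ℝ) - v) + Ω := by
            rw [norm_neg, norm_real, Real.norm_eq_abs, abs_sub_comm]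
            exact add_le_add hmove (hosc v (by rw [min_eq_right h]) (by rw [max_eq_left h]; exact h))
        _ ≤ ε := by
            have : 4 / m * ((s : ℝ) - v) ≤ 4 * δ / m := by
              rw [div_mul_eq_mul_div]; gcongr; linarith [(abs_le.1 hvs).1]
            linarith
    · have hsmall : 4 * ((v : ℝ) - s) / m + Ω < m / 2 := by
        have : (v : ℝ) - s ≤ δ := by linarith [(abs_le.1 hvs).2]
        have : 4 * ((v : ℝ) - s) / m ≤ 4 * δ / m := by gcongr
        linarith
      obtain ⟨hfar, hmove⟩ := norm_map_sub_ge_of_after hW h (lt_swallowingTime_of_alive hA hv ha) hm0 hms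
        (fun r hr1 hr2 ↦ hosc r (by rw [min_eq_left h]; exact hr1) (by rw [max_eq_right h]; exact hr2)) hsmall h le_rfl
      refine ⟨hfar, ?_⟩
      calc ‖(map W v a - W v) - (map W s a - W s)‖ = ‖(map W v a - map W s a) + -(((W v - W s : ℝ)) : ℂ)‖ := by
            push_cast; ring_nf
        _ ≤ ‖map W v a - map W s a‖ + ‖-(((W v - W s : ℝ)) : ℂ)‖ := norm_add_le _ _
        _ ≤ 4 / m * ((v : ℝ) - s) + Ω := by
            rw [norm_neg, norm_real, Real.norm_eq_abs]
            exact add_le_add hmove (hosc v (by rw [min_eq_left h]; exact h) (by rw [max_eq_right h]))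
        _ ≤ ε := by
            have : 4 / m * ((v : ℝ) - s) ≤ 4 * δ / m := by
              rw [div_mul_eq_mul_div]; gcongr; linarith [(abs_le.1 hvs).2]
            linarith
  refine ⟨fun a ha ↦ (hpt a ha).2, ?_, fun r hr1 hr2 ↦ (hosc r hr1 hr2).trans (min_le_left _ _ |>.trans (by linarith))⟩
  refine Set.disjoint_left.2 fun w hw hwB ↦ ?_
  obtain ⟨a, ha, rfl⟩ := hwB
  have := (hpt a ha).1
  rw [mem_ball_zero_iff] at hw
  linarith

/-! ### Continuity of `t ↦ m_t = infDist 0 B_t` -/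

/-- **`t ↦ dist(W_t, g_t(A))` is continuous** on the alive times (`A ≠ ∅`).
[cite: LawlerSchrammWerner2003Restriction, §5] -/
theorem continuousWithinAt_infDist_slidHull (hW : Continuous W) (hA : IsStarHull A) (hne : A.Nonempty)
    {s : ℝ≥0} (hs : Disjoint (closedHull W s) A) :
    ContinuousWithinAt (fun v : ℝ≥0 ↦ infDist 0 (slidHull W A v)) {v | Disjoint (closedHull W v) A} s := by
  obtain ⟨ρ, hρ, hρm, htube⟩ := exists_tube_at hW hA hne hs
  rw [Metric.continuousWithinAt_iff]
  intro ε hε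
  obtain ⟨δ, hδ, hδv⟩ := htube (ε / 2) (by positivity)
  refine ⟨δ, hδ, fun {v} hv hvs ↦ ?_⟩
  obtain ⟨hpt, -, -⟩ := hδv v hv (by rw [NNReal.dist_eq] at hvs; exact hvs.le)
  rw [Real.dist_eq, abs_lt]
  -- both hulls are images of `A`; compare along the flow of each point
  have hne_s : (slidHull W A s).Nonempty := hne.image _
  have hne_v : (slidHull W A v).Nonempty := hne.image _
  have h1 : infDist 0 (slidHull W A v) ≤ infDist 0 (slidHull W A s) + ε / 2 := by
    obtain ⟨y, hy, hyd⟩ := (isStarHull_slidHull_of_disjoint hW hA hs).isBoundedHull.isCompact.exists_infDist_eq_dist hne_s 0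
    obtain ⟨a, ha, rfl⟩ := hy
    have hmem : map W v a - W v ∈ slidHull W A v := mem_slidHull_iff.2 ⟨a, ha, rfl⟩
    calc infDist 0 (slidHull W A v) ≤ dist 0 (map W v a - W v) := infDist_le_dist_of_mem hmem
      _ ≤ dist 0 (map W s a - W s) + dist (map W s a - W s) (map W v a - W v) := dist_triangle _ _ _
      _ ≤ infDist 0 (slidHull W A s) + ε / 2 := by
          rw [← hyd, dist_comm (map W s a - _), dist_eq_norm]; exact add_le_add le_rfl (hpt a ha)
  have h2 : infDist 0 (slidHull W A s) ≤ infDist 0 (slidHull W A v) + ε / 2 := by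
    obtain ⟨y, hy, hyd⟩ := (isStarHull_slidHull_of_disjoint hW hA hv).isBoundedHull.isCompact.exists_infDist_eq_dist hne_v 0
    obtain ⟨a, ha, rfl⟩ := hy
    have hmem : map W s a - W s ∈ slidHull W A s := mem_slidHull_iff.2 ⟨a, ha, rfl⟩
    calc infDist 0 (slidHull W A s) ≤ dist 0 (map W s a - W s) := infDist_le_dist_of_mem hmem
      _ ≤ dist 0 (map W v a - W v) + dist (map W v a - W v) (map W s a - W s) := dist_triangle _ _ _
      _ ≤ infDist 0 (slidHull W A v) + ε / 2 := by
          rw [← hyd, dist_eq_norm]; exact add_le_add le_rfl (hpt a ha)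
  constructor <;> linarith

/-! ### Hulls close to `B_s` lie in a thin thickened hull of `B_s` -/

/-- If every point of `S ⊆ ℍ̄` is within `ε` of `B` (`ε > 0`), then `S ⊆ thickHull B (2ε)`.
[folklore] -/
theorem subset_thickHull_of_near {S B : Set ℂ} {ε : ℝ} (hε : 0 < ε)
    (him : ∀ w ∈ S, 0 ≤ w.im) (hnear : ∀ w ∈ S, ∃ y ∈ B, dist w y ≤ ε) : S ⊆ thickHull B (2 * ε) := by
  intro w hw
  obtain ⟨y, hy, hyd⟩ := hnear w hw
  -- the points `w + i t`, `0 < t ≤ ε`, are in `nbhdSet B (2ε) ∩ ℍ ⊆ hpFill = thickHull`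
  have hup : ∀ t : ℝ, 0 < t → t ≤ ε → w + t * I ∈ thickHull B (2 * ε) := by
    intro t ht htε
    refine inter_subset_hpFill _ ⟨⟨?_, ?_⟩, ?_⟩
    · refine mem_cthickening_of_dist_le _ y _ _ hy ?_
      calc dist (w + t * I) y ≤ dist (w + t * I) w + dist w y := dist_triangle _ _ _
        _ ≤ ε + ε := by
            refine add_le_add ?_ hyd
            rw [dist_eq_norm, add_sub_cancel_left, norm_mul, norm_real, norm_I, mul_one, Real.norm_of_nonneg ht.le]
            exact htε
        _ = 2 * ε := by ring
    · show 0 ≤ (w + t * I).im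
      simp; linarith [him w hw]
    · show 0 < (w + t * I).im
      simp; linarith [him w hw]
  -- `w` is the limit of `w + i/n`
  have hlim : Tendsto (fun n : ℕ ↦ w + ((ε / (n + 1) : ℝ) : ℂ) * I) atTop (𝓝 w) := by
    have h1 : Tendsto (fun n : ℕ ↦ (ε / ((n : ℝ) + 1))) atTop (𝓝 0) :=
      tendsto_const_nhds.div_atTop (tendsto_natCast_atTop_atTop.atTop_add tendsto_const_nhds)
    have h2 : Tendsto (fun n : ℕ ↦ w + ((ε / ((n : ℝ) + 1) : ℝ) : ℂ) * I) atTop (𝓝 (w + ((0 : ℝ) : ℂ) * I)) :=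
      tendsto_const_nhds.add ((continuous_ofReal.tendsto 0 |>.comp h1).mul tendsto_const_nhds)
    simpa using h2
  refine (isClosed_thickHull B (2 * ε)).mem_of_tendsto hlim (Eventually.of_forall fun n ↦ hup _ (by positivity) ?_)
  rw [div_le_iff₀ (by positivity)]
  nlinarith [hε, (n.cast_nonneg : (0:ℝ) ≤ n)]

/-! ### Continuity of `t ↦ d_t = Φ'_{A_t}(W_t)` -/

/-- **Lower bound near an alive time**: `d_v ≥ d_s/2` for all alive `v` close to `s` (outer
continuity of `Φ'`, applied to a thin thickened hull of `B_s` containing `B_v`, and antitonicity).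
[cite: LawlerSchrammWerner2003Restriction, §2 (2.4) and §5] -/
theorem exists_forall_starDeriv_ge_half (hW : Continuous W) (hA : IsStarHull A) (hne : A.Nonempty)
    {s : ℝ≥0} (hs : Disjoint (closedHull W s) A) :
    ∃ δ > 0, ∀ v : ℝ≥0, Disjoint (closedHull W v) A → |(v : ℝ) - s| ≤ δ →
      starDeriv (slidHull W A s) / 2 ≤ starDeriv (slidHull W A v) := by
  have hBs := isStarHull_slidHull_of_disjoint hW hA hs
  have hne_s : (slidHull W A s).Nonempty := hne.image _
  obtain ⟨hd0, hd1, hd⟩ := starDeriv_spec hBs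
  -- outer continuity with `ε = 1/2`
  obtain ⟨δo, hδo, hout⟩ := hd.exists_forall_outer_ge hBs hne_s (isRestrictionMap_starRMap hBs) (ε := 1 / 2) (by norm_num)
  -- thin thickened hulls of `B_s` are `*`-hulls
  obtain ⟨s₀, hs₀, hthick⟩ := exists_forall_isStarHull_thickHull isSimplyConnected_of_isConnected_compl_holds hBs
  set ε : ℝ := min (δo / 2) (s₀ / 4) with hε
  have hε0 : 0 < ε := lt_min (by positivity) (by positivity)
  have h2ε : 2 * ε ≤ δo := by have := min_le_left (δo / 2) (s₀ / 4); linarith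
  have h2ε' : 2 * ε < s₀ := by have := min_le_right (δo / 2) (s₀ / 4); linarith
  have hH : IsStarHull (thickHull (slidHull W A s) (2 * ε)) := hthick _ (by positivity) h2ε'
  obtain ⟨ρ, hρ, -, htube⟩ := exists_tube_at hW hA hne hs
  obtain ⟨δ, hδ, hδv⟩ := htube ε hε0
  refine ⟨δ, hδ, fun v hv hvs ↦ ?_⟩
  obtain ⟨hpt, -, -⟩ := hδv v hv hvs
  have hBv := isStarHull_slidHull_of_disjoint hW hA hv
  -- `B_v ⊆ H := thickHull B_s (2ε)` and `B_s ⊆ H ⊆ thickHull B_s δo`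
  have hsubv : slidHull W A v ⊆ thickHull (slidHull W A s) (2 * ε) := by
    refine subset_thickHull_of_near hε0 (fun w hw ↦ im_nonneg_of_mem_slidHull hW hA hv hw) fun w hw ↦ ?_
    obtain ⟨a, ha, rfl⟩ := hw
    exact ⟨map W s a - W s, mem_slidHull_iff.2 ⟨a, ha, rfl⟩, by rw [dist_eq_norm]; exact hpt a ha⟩
  have hsubs : slidHull W A s ⊆ thickHull (slidHull W A s) (2 * ε) :=
    subset_thickHull_of_near hε0 (fun w hw ↦ im_nonneg_of_mem_slidHull hW hA hs hw)
      fun w hw ↦ ⟨w, hw, by rw [dist_self]; exact hε0.le⟩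
  have hHsub : thickHull (slidHull W A s) (2 * ε) ⊆ thickHull (slidHull W A s) δo := thickHull_mono _ h2ε
  -- `d_H ≥ d_s / 2` and `d_v ≥ d_H`
  obtain ⟨-, -, hdH⟩ := starDeriv_spec hH
  have h1 := hout hH hsubs hHsub (isRestrictionMap_starRMap hH) hdH
  obtain ⟨-, -, hdv⟩ := starDeriv_spec hBv
  have h2 := HasRestrictionDeriv.le_of_subset hH hBv hsubv (isRestrictionMap_starRMap hH) (isRestrictionMap_starRMap hBv) hdH hdv
  linarith

/-- Oscillation bound for the shifted driver. [folklore] -/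
theorem abs_shiftDriver_le {s u : ℝ≥0} {c : ℝ}
    (hosc : ∀ r : ℝ≥0, s ≤ r → r ≤ s + u → |W r - W s| ≤ c) :
    ∀ r : ℝ≥0, r ≤ u → |(fun r ↦ W (s + r) - W s) r| ≤ c := fun r hr ↦
  hosc (s + r) le_self_add (by gcongr)

/-- `stepSize c u ≤ c + 4 √δ` for `u ≤ δ`. [folklore] -/
theorem stepSize_le_of_le {c δ : ℝ} {u : ℝ≥0} (hu : (u : ℝ) ≤ δ) : stepSize c u ≤ c + 4 * Real.sqrt δ := by
  rw [stepSize]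
  have := Real.sqrt_le_sqrt hu
  linarith

/-- **`t ↦ Φ'_{A_t}(W_t)` is continuous** on the alive times (`A ≠ ∅`): for alive `v` near `s`,
`|d_v - d_s| ≤ 50|v-s|/ρ² + 2η/ρ → 0`, by the one-step estimate applied forward from `s` (if
`v > s`) or forward from `v` (if `v < s`, where `d_v ≥ d_s/2` and `B_v` misses `ball 0 (8ρ)` keep
the constants uniform), the two hulls being related by the cocycle `slidHull_add`.
[cite: LawlerSchrammWerner2003Restriction, §5 (h_t'(W_t) continuous in t)] -/
theorem continuousWithinAt_starDeriv_slidHull (hW : Continuous W) (hA : IsStarHull A) (hne : A.Nonempty)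
    {s : ℝ≥0} (hs : Disjoint (closedHull W s) A) :
    ContinuousWithinAt (fun v : ℝ≥0 ↦ starDeriv (slidHull W A v)) {v | Disjoint (closedHull W v) A} s := by
  have hBs := isStarHull_slidHull_of_disjoint hW hA hs
  obtain ⟨hd0, hd1, -⟩ := starDeriv_spec hBs
  set d₀ := starDeriv (slidHull W A s) with hd₀
  obtain ⟨ρ, hρ, hρm, htube⟩ := exists_tube_at hW hA hne hs
  obtain ⟨δh, hδh, hhalf⟩ := exists_forall_starDeriv_ge_half hW hA hne hs
  rw [Metric.continuousWithinAt_iff]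
  intro ε hε
  -- constants
  set c : ℝ := min (ε * ρ / 16) (d₀ * ρ / 8000) with hc
  have hc0 : 0 < c := lt_min (by positivity) (by positivity)
  have hc1 : c ≤ ε * ρ / 16 := min_le_left _ _
  have hc2 : c ≤ d₀ * ρ / 8000 := min_le_right _ _
  obtain ⟨δt, hδt, htubev⟩ := htube c hc0
  set δ : ℝ := min δt (min δh (min ((c / 4) ^ 2) (ε * ρ ^ 2 / 100))) with hδ
  have hδ0 : 0 < δ := lt_min hδt (lt_min hδh (lt_min (by positivity) (by positivity)))
  have hδ_t : δ ≤ δt := min_le_left _ _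
  have hδ_h : δ ≤ δh := (min_le_right _ _).trans (min_le_left _ _)
  have hδ_c : δ ≤ (c / 4) ^ 2 := (min_le_right _ _).trans ((min_le_right _ _).trans (min_le_left _ _))
  have hδ_ε : δ ≤ ε * ρ ^ 2 / 100 := (min_le_right _ _).trans ((min_le_right _ _).trans (min_le_right _ _))
  have hsqrt : 4 * Real.sqrt δ ≤ c := by
    have := Real.sqrt_le_sqrt hδ_c
    rw [Real.sqrt_sq (by positivity)] at this
    linarith
  refine ⟨δ, hδ0, fun {v} hv hvs ↦ ?_⟩
  rw [NNReal.dist_eq] at hvs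
  obtain ⟨-, hballv, hosc⟩ := htubev v hv (hvs.le.trans hδ_t)
  have hdv := hhalf v hv (hvs.le.trans hδ_h)
  have hBv := isStarHull_slidHull_of_disjoint hW hA hv
  -- the ball `B(0, 8ρ)` misses `B_s` as well
  have hballs : Disjoint (ball (0 : ℂ) (8 * ρ)) (slidHull W A s) := by
    obtain ⟨-, h⟩ := infDist_zero_pos hBs (hne.image _)
    exact h.mono_left (ball_subset_ball (by linarith))
  rw [Real.dist_eq]
  -- the target bound
  have hgoal : ∀ {x : ℝ}, |x| ≤ 50 * δ / ρ ^ 2 + 2 * (3 * c) / ρ → |x| < ε := fun {x} hx ↦ by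
    have h1 : 50 * δ / ρ ^ 2 ≤ ε / 2 := by
      rw [div_le_iff₀ (by positivity)]; nlinarith
    have h2 : 2 * (3 * c) / ρ ≤ 3 * ε / 8 := by
      rw [div_le_iff₀ hρ]; nlinarith
    linarith
  rcases lt_trichotomy v s with hlt | heq | hgt
  · -- `v < s`: step forward from `v` for time `u = s - v`
    set u : ℝ≥0 := s - v with hu
    have hvu : v + u = s := add_tsub_cancel_of_le hlt.le
    have hu0 : 0 < u := tsub_pos_of_lt hlt
    have huδ : (u : ℝ) ≤ δ := by
      rw [hu, NNReal.coe_sub hlt.le]; linarith [(abs_lt.1 hvs).1]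
    set U : ℝ≥0 → ℝ := fun r ↦ W (v + r) - W v with hU
    obtain ⟨hUc, hU0⟩ := continuous_shiftDriver hW v
    have hS : ∀ r : ℝ≥0, r ≤ u → |U r| ≤ 2 * c := by
      intro r hr
      have h1 : |W (v + r) - W s| ≤ c := hosc (v + r) (by rw [min_eq_right hlt.le]; exact le_self_add)
        (by rw [max_eq_left hlt.le, ← hvu]; gcongr)
      have h2 : |W v - W s| ≤ c := hosc v (by rw [min_eq_right hlt.le]) (by rw [max_eq_left hlt.le]; exact hlt.le)
      calc |U r| = |(W (v + r) - W s) - (W v - W s)| := by simp only [hU]; ring_nf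
        _ ≤ |W (v + r) - W s| + |W v - W s| := abs_sub _ _
        _ ≤ 2 * c := by linarith
    have hη : stepSize (2 * c) u ≤ starDeriv (slidHull W A v) * ρ / 1000 := by
      have := stepSize_le_of_le (c := 2 * c) huδ
      have h3 : 2 * c + 4 * Real.sqrt δ ≤ 3 * c := by linarith
      have h4 : 3 * c ≤ d₀ / 2 * ρ / 1000 := by nlinarith
      have h5 : d₀ / 2 * ρ / 1000 ≤ starDeriv (slidHull W A v) * ρ / 1000 := by
        gcongr
      linarith
    have key := abs_starDeriv_slidHull_sub_le hBv hUc hU0 hu0 hS hρ hballv hη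
    -- the slid hull of `B_v` by `U` for time `u` is `B_s`
    have hcoc : slidHull U (slidHull W A v) u = slidHull W A s := by
      rw [← hvu]
      exact (slidHull_add hW fun a ha ↦ by rw [hvu]; exact lt_swallowingTime_of_alive hA hs ha).symm
    rw [hcoc] at key
    rw [abs_sub_comm] at key
    refine hgoal (key.trans ?_)
    have e1 : 50 * (u : ℝ) / ρ ^ 2 ≤ 50 * δ / ρ ^ 2 := by gcongr
    have e2 : 2 * stepSize (2 * c) u / ρ ≤ 2 * (3 * c) / ρ := by
      have := stepSize_le_of_le (c := 2 * c) huδ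
      gcongr
      linarith
    linarith
  · subst heq; simpa using hε
  · -- `s < v`: step forward from `s` for time `u = v - s`
    set u : ℝ≥0 := v - s with hu
    have hsu : s + u = v := add_tsub_cancel_of_le hgt.le
    have hu0 : 0 < u := tsub_pos_of_lt hgt
    have huδ : (u : ℝ) ≤ δ := by
      rw [hu, NNReal.coe_sub hgt.le]; linarith [(abs_lt.1 hvs).2]
    set U : ℝ≥0 → ℝ := fun r ↦ W (s + r) - W s with hU
    obtain ⟨hUc, hU0⟩ := continuous_shiftDriver hW s
    have hS : ∀ r : ℝ≥0, r ≤ u → |U r| ≤ 2 * c := by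
      intro r hr
      have h1 : |W (s + r) - W s| ≤ c := hosc (s + r) (by rw [min_eq_left hgt.le]; exact le_self_add)
        (by rw [max_eq_right hgt.le, ← hsu]; gcongr)
      simp only [hU]
      linarith [abs_nonneg (W (s + r) - W s)]
    have hη : stepSize (2 * c) u ≤ starDeriv (slidHull W A s) * ρ / 1000 := by
      have := stepSize_le_of_le (c := 2 * c) huδ
      have h3 : 2 * c + 4 * Real.sqrt δ ≤ 3 * c := by linarith
      have h4 : 3 * c ≤ d₀ * ρ / 1000 := by nlinarith
      linarith
    have key := abs_starDeriv_slidHull_sub_le hBs hUc hU0 hu0 hS hρ hballs hη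
    have hcoc : slidHull U (slidHull W A s) u = slidHull W A v := by
      rw [← hsu]
      exact (slidHull_add hW fun a ha ↦ by rw [hsu]; exact lt_swallowingTime_of_alive hA hv ha).symm
    rw [hcoc] at key
    refine hgoal (key.trans ?_)
    have e1 : 50 * (u : ℝ) / ρ ^ 2 ≤ 50 * δ / ρ ^ 2 := by gcongr
    have e2 : 2 * stepSize (2 * c) u / ρ ≤ 2 * (3 * c) / ρ := by
      have := stepSize_le_of_le (c := 2 * c) huδ
      gcongr
      linarith
    linarith

/-- **`t ↦ Y_t = Φ'_{A_t}(W_t)^{5/8}` is continuous** on the alive times. [cite: LawlerSchrammWerner2003Restriction, §5 (Y_t, t < T)] -/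
theorem continuousWithinAt_rpow_starDeriv_slidHull (hW : Continuous W) (hA : IsStarHull A) (hne : A.Nonempty)
    {s : ℝ≥0} (hs : Disjoint (closedHull W s) A) (p : ℝ) :
    ContinuousWithinAt (fun v : ℝ≥0 ↦ starDeriv (slidHull W A v) ^ p) {v | Disjoint (closedHull W v) A} s := by
  have hd0 := (starDeriv_spec (isStarHull_slidHull_of_disjoint hW hA hs)).1
  exact (continuousWithinAt_starDeriv_slidHull hW hA hne hs).rpow_const (Or.inl hd0.ne')

end Loewner

end Literature.Probability.RandomPlanarGeometry
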